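import Summits.NavierStokesRegularity.NavierStokesRegularity.Theorems.AxisTwistDoorAveragedConeLiouvilleNUWeakEnergyLimit
import Summits.NavierStokesRegularity.NavierStokesRegularity.Theorems.AxisTwistDoorAveragedConeLiouvilleNUWeakDefs
import HarnessLib

/-!
# N4 / T1 piece W1: `nu_weakEnergyIdentity : Sig.nu_weakEnergyIdentity` — the energy inequality of a
# LIPSCHITZ generalized supersolution on a time slab `[t₁,t₂]` (before the divergence-free transfer)

Route `AxisTwistDoor`, crux `AveragedConeLiouville` (stmt-NavierStokesRegularity-26889), INPUT N4 / T1,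
programme `kits/N4-T1-skeleton.lean` (118454bf17607d1e), `kits/N4-T1-plan.md` v2 §7 brick (B5) = W1:
`h → 0⁺` in W1b (`nu_weakEnergy_slab`, p639159) with the plateau `χ_h` of brick B1 (`exists_slab_cutoff`):
the bulk terms by dominated convergence (`tendsto_integral_cutoff`, `tendsto_slab_cutoff_indicator`),
the two Steklov means by Fubini (`setIntegral_slab_eq`), the continuity of the slice energy
(`continuousOn_sliceEnergy`) and `tendsto_steklov_left/right`; then the cutoff integrals over the
cylinder are the integrals over `[t₁,t₂] × ℝ³` (`setIntegral_Icc_univ_eq_cutoff`), and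
`∫ η′H(V)Θ² ≤ ∫ |η′|H(V)Θ²` (`H ≥ 0`). The type is the tree text `Sig.nu_weakEnergyIdentity` of
`…Theorems.AxisTwistDoorAveragedConeLiouvilleNUWeakDefs` (= kit l.149).

WHAT THIS IS NOT: not a statement about Navier–Stokes; T1 is an INPUT; item 26889 and the summit
stay open. [cite: NazarovUraltseva2011HarnackDivFree, §1 p. 2–3, §3 (3.2) (arXiv:1011.1888 p. 8)]
-/

noncomputable section

-- the summit and its single sub-problem share the name (CONVENTIONS §1)
set_option linter.dupNamespace false

open MeasureTheory Set Function Filter Topology Metric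
open scoped NNReal ENNReal InnerProductSpace RealInnerProductSpace

namespace Summit.NavierStokesRegularity.NavierStokesRegularity.Theorems.AveragedConeLiouville.NUPositivity

/-- **Integrability of the three `η`-weighted bulk pieces on the cylinder** (from
`nu_weak_pieces_bound` / `nu_weak_pieces_aesm` with `c = η`). [folklore] -/
theorem integrable_eta_pieces {T : ℝ} {V : ℝ → EuclideanSpace ℝ (Fin 3) → ℝ}
    {b : ℝ → EuclideanSpace ℝ (Fin 3) → EuclideanSpace ℝ (Fin 3)} (hbm : Measurable (uncurry b))
    (hbΛ : ∃ Λ : ℝ, ∀ t ∈ Ioo 0 T, ∀ x ∈ ball (0 : EuclideanSpace ℝ (Fin 3)) 1, ‖b t x‖ ≤ Λ)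
    (hVlip : ∃ L, LipschitzOnWith L (uncurry V) (Ioo 0 T ×ˢ ball (0 : EuclideanSpace ℝ (Fin 3)) 1))
    {H : ℝ → ℝ} (hH : ContDiff ℝ 2 H) {Θ : EuclideanSpace ℝ (Fin 3) → ℝ} (hΘ : ContDiff ℝ 1 Θ)
    (hΘc : HasCompactSupport Θ) {η : ℝ → ℝ} (hη : Continuous η) :
    Integrable (fun p : ℝ × EuclideanSpace ℝ (Fin 3) =>
        η p.1 * (deriv (deriv H) (V p.1 p.2) * ‖gradient (V p.1) p.2‖ ^ 2 * Θ p.2 ^ 2))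
        (volume.restrict (Ioo 0 T ×ˢ ball (0 : EuclideanSpace ℝ (Fin 3)) 1)) ∧
      Integrable (fun p : ℝ × EuclideanSpace ℝ (Fin 3) =>
        η p.1 * (deriv H (V p.1 p.2) * ⟪gradient (V p.1) p.2, gradient (fun y => Θ y ^ 2) p.2⟫))
        (volume.restrict (Ioo 0 T ×ˢ ball (0 : EuclideanSpace ℝ (Fin 3)) 1)) ∧
      Integrable (fun p : ℝ × EuclideanSpace ℝ (Fin 3) =>
        η p.1 * (Θ p.2 ^ 2 * (deriv H (V p.1 p.2) * ⟪b p.1 p.2, gradient (V p.1) p.2⟫)))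
        (volume.restrict (Ioo 0 T ×ˢ ball (0 : EuclideanSpace ℝ (Fin 3)) 1)) := by
  obtain ⟨Λ, hΛ⟩ := hbΛ
  obtain ⟨L, hL⟩ := hVlip
  obtain ⟨g, hg, hVg⟩ := hL.extend_real
  obtain ⟨C, hC⟩ := nu_weak_pieces_bound hΛ hg hVg hH hΘ hΘc hη
  obtain ⟨-, hm₂, hm₃, hm₄⟩ := nu_weak_pieces_aesm hbm hg hVg hH hΘ hη
  set W : Set (ℝ × EuclideanSpace ℝ (Fin 3)) := Ioo 0 T ×ˢ ball (0 : EuclideanSpace ℝ (Fin 3)) 1 with hW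
  have hWm : MeasurableSet W := (isOpen_Ioo.prod isOpen_ball).measurableSet
  have hWfin : volume W < ∞ :=
    (measure_mono (Set.prod_mono Ioo_subset_Icc_self ball_subset_closedBall)).trans_lt
      ((isCompact_Icc.prod (isCompact_closedBall (0 : EuclideanSpace ℝ (Fin 3)) 1)).measure_lt_top)
  haveI : (volume : Measure (ℝ × EuclideanSpace ℝ (Fin 3))).IsAddHaarMeasure := by
    change ((volume : Measure ℝ).prod (volume : Measure (EuclideanSpace ℝ (Fin 3)))).IsAddHaarMeasure
    infer_instance
  have hae : ∀ᵐ p ∂(volume.restrict W), p ∈ W ∧ DifferentiableAt ℝ g p :=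
    (ae_restrict_mem hWm).and (ae_restrict_of_ae (hg.ae_differentiableAt (μ := volume)))
  have hKint : Integrable (fun _ : ℝ × EuclideanSpace ℝ (Fin 3) => C) (volume.restrict W) :=
    integrableOn_const hWfin.ne
  refine ⟨hKint.mono' hm₂ ?_, hKint.mono' hm₃ ?_, hKint.mono' hm₄ ?_⟩
  · filter_upwards [hae] with p hp
    rw [Real.norm_eq_abs]; exact (hC p hp.1 hp.2).2.1
  · filter_upwards [hae] with p hp
    rw [Real.norm_eq_abs]; exact (hC p hp.1 hp.2).2.2.1
  · filter_upwards [hae] with p hp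
    rw [Real.norm_eq_abs]; exact (hC p hp.1 hp.2).2.2.2

/-- **W1 = `Sig.nu_weakEnergyIdentity`: the energy inequality of a Lipschitz generalized supersolution
on a time slab** (module docstring). [cite: NazarovUraltseva2011HarnackDivFree, §1 p. 2–3, §3 (3.2) (arXiv:1011.1888 p. 8)] -/
theorem nu_weakEnergyIdentity : Sig.nu_weakEnergyIdentity := by
  intro T V b hbm hbΛ hVlip _hV0 hweak H hH hH' hH0 Θ hΘ hΘc ρ₀ hρ₀ hΘρ η hη hη0 t₁ t₂ ht₁ h12 ht₂
  ----------------------------------------------------------------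
  -- setup
  ----------------------------------------------------------------
  set W : Set (ℝ × EuclideanSpace ℝ (Fin 3)) := Ioo 0 T ×ˢ ball (0 : EuclideanSpace ℝ (Fin 3)) 1 with hW
  have hWm : MeasurableSet W := (isOpen_Ioo.prod isOpen_ball).measurableSet
  have hΘ1 : ∀ x, x ∉ ball (0 : EuclideanSpace ℝ (Fin 3)) 1 → Θ x = 0 := fun x hx =>
    image_eq_zero_of_notMem_tsupport fun h' => hx (ball_subset_ball hρ₀.le (hΘρ h'))
  have hgradΘ1 : ∀ x, x ∉ ball (0 : EuclideanSpace ℝ (Fin 3)) 1 → gradient (fun y => Θ y ^ 2) x = 0 := by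
    intro x hx
    have h := ((hΘ.differentiable one_ne_zero) x).hasFDerivAt.pow 2
    rw [gradient, h.fderiv, hΘ1 x hx]
    simp
  have ht₁T : t₁ ∈ Ioo 0 T := ⟨ht₁, lt_of_le_of_lt h12 ht₂⟩
  have ht₂T : t₂ ∈ Ioo 0 T := ⟨ht₁.trans_le h12, ht₂⟩
  -- the integrable pieces
  obtain ⟨hF₂, hF₃, hF₄⟩ := integrable_eta_pieces hbm hbΛ hVlip hH hΘ hΘc hη.continuous
  have hG := integrableOn_H_comp_mul hVlip hH.continuous hΘ.continuous
  obtain ⟨Cη', hCη'⟩ := isCompact_Icc.exists_bound_of_continuousOn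
    ((hη.continuous_deriv le_rfl).continuousOn (s := Icc 0 T))
  have hG₁ : Integrable (fun p : ℝ × EuclideanSpace ℝ (Fin 3) =>
      deriv η p.1 * (H (V p.1 p.2) * Θ p.2 ^ 2)) (volume.restrict W) := by
    refine hG.bdd_mul (c := Cη') (((hη.continuous_deriv le_rfl).comp continuous_fst).aestronglyMeasurable) ?_
    filter_upwards [ae_restrict_mem hWm] with p hp
    exact hCη' p.1 (Ioo_subset_Icc_self hp.1)
  have hG₁' : Integrable (fun p : ℝ × EuclideanSpace ℝ (Fin 3) =>
      |deriv η p.1| * (H (V p.1 p.2) * Θ p.2 ^ 2)) (volume.restrict W) := by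
    refine hG.bdd_mul (c := Cη')
      (((hη.continuous_deriv le_rfl).comp continuous_fst).abs.aestronglyMeasurable) ?_
    filter_upwards [ae_restrict_mem hWm] with p hp
    rw [Real.norm_eq_abs, abs_abs]
    exact (Real.norm_eq_abs _).symm.le.trans (hCη' p.1 (Ioo_subset_Icc_self hp.1))
  ----------------------------------------------------------------
  -- the plateaux `χ_h` and W1b for small `h`
  ----------------------------------------------------------------
  choose! χ hχL hχb hχl hχr hχ1 _hχup _hχdn hχd using
    fun h (hh : 0 < h) => exists_slab_cutoff (t₁ := t₁) (t₂ := t₂) h12 hh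
  have hχc : ∀ h, 0 < h → Continuous (χ h) := fun h hh => (hχL h hh).continuous
  have hχa : ∀ h, 0 < h → ∀ t, |χ h t| ≤ 1 := fun h hh t => by
    rw [abs_of_nonneg ((hχb h hh) t).1]; exact ((hχb h hh) t).2
  have hχlim := tendsto_slab_cutoff_indicator (χ := χ) hχ1 hχl hχr
  have hB4 : ∀ h, 0 < h → h < t₁ → t₂ + h < T →
      (∫ p in W, χ h p.1 *
          (η p.1 * (deriv (deriv H) (V p.1 p.2) * ‖gradient (V p.1) p.2‖ ^ 2 * Θ p.2 ^ 2))) ≤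
        (∫ p in W, χ h p.1 * (deriv η p.1 * (H (V p.1 p.2) * Θ p.2 ^ 2))) +
          h⁻¹ * (∫ p in Ioo (t₁ - h) t₁ ×ˢ ball (0 : EuclideanSpace ℝ (Fin 3)) 1,
            η p.1 * (H (V p.1 p.2) * Θ p.2 ^ 2)) -
          h⁻¹ * (∫ p in Ioo t₂ (t₂ + h) ×ˢ ball (0 : EuclideanSpace ℝ (Fin 3)) 1,
            η p.1 * (H (V p.1 p.2) * Θ p.2 ^ 2)) -
          (∫ p in W, χ h p.1 * (η p.1 * (deriv H (V p.1 p.2) *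
            ⟪gradient (V p.1) p.2, gradient (fun y => Θ y ^ 2) p.2⟫))) -
          (∫ p in W, χ h p.1 *
            (η p.1 * (Θ p.2 ^ 2 * (deriv H (V p.1 p.2) * ⟪b p.1 p.2, gradient (V p.1) p.2⟫)))) := by
    intro h hh h1 h2
    have hB := nu_weakEnergy_slab hbm hbΛ hVlip hweak hH hH' hΘ hΘc hρ₀ hΘρ hη hη0 hh (by linarith)
      h12 h2 (hχL h hh) (hχb h hh) (hχl h hh) (hχr h hh) (hχd h hh)
    have e : ∀ F : ℝ × EuclideanSpace ℝ (Fin 3) → ℝ, ∀ w : ℝ → ℝ,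
        ∫ p in W, w p.1 * χ h p.1 * F p = ∫ p in W, χ h p.1 * (w p.1 * F p) := fun F w =>
      integral_congr_ae (Eventually.of_forall fun p => by ring)
    rw [e, e, e, e] at hB
    exact hB
  ----------------------------------------------------------------
  -- the limits `h → 0⁺`
  ----------------------------------------------------------------
  have T2 := tendsto_integral_cutoff (t₁ := t₁) (t₂ := t₂) hF₂ hχc hχa hχlim
  have T1 := tendsto_integral_cutoff (t₁ := t₁) (t₂ := t₂) hG₁ hχc hχa hχlim
  have T3 := tendsto_integral_cutoff (t₁ := t₁) (t₂ := t₂) hF₃ hχc hχa hχlim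
  have T4 := tendsto_integral_cutoff (t₁ := t₁) (t₂ := t₂) hF₄ hχc hχa hχlim
  have hMc : ContinuousOn (fun t => η t * ∫ x, H (V t x) * Θ x ^ 2) (Ioo 0 T) :=
    hη.continuous.continuousOn.mul (continuousOn_sliceEnergy hVlip hH.continuous hΘ.continuous hΘ1)
  have hpos : ∀ᶠ h in 𝓝[>] (0 : ℝ), 0 < h := eventually_mem_nhdsWithin
  have S1 : Tendsto (fun h : ℝ => h⁻¹ * ∫ p in Ioo (t₁ - h) t₁ ×ˢ ball (0 : EuclideanSpace ℝ (Fin 3)) 1,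
      η p.1 * (H (V p.1 p.2) * Θ p.2 ^ 2)) (𝓝[>] 0) (𝓝 (η t₁ * ∫ x, H (V t₁ x) * Θ x ^ 2)) := by
    refine (tendsto_steklov_left hMc ht₁T).congr' ?_
    filter_upwards [hpos, Ioo_mem_nhdsGT ht₁] with h hh hh'
    rw [setIntegral_slab_eq hVlip hH.continuous hΘ.continuous hΘ1 hη.continuous
      (fun t ht => ⟨by linarith [ht.1, hh'.2], ht.2.trans ht₁T.2⟩)]
  have S2 : Tendsto (fun h : ℝ => h⁻¹ * ∫ p in Ioo t₂ (t₂ + h) ×ˢ ball (0 : EuclideanSpace ℝ (Fin 3)) 1,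
      η p.1 * (H (V p.1 p.2) * Θ p.2 ^ 2)) (𝓝[>] 0) (𝓝 (η t₂ * ∫ x, H (V t₂ x) * Θ x ^ 2)) := by
    refine (tendsto_steklov_right hMc ht₂T).congr' ?_
    filter_upwards [hpos, Ioo_mem_nhdsGT (show (0 : ℝ) < T - t₂ by linarith)] with h hh hh'
    rw [setIntegral_slab_eq hVlip hH.continuous hΘ.continuous hΘ1 hη.continuous
      (fun t ht => ⟨ht₂T.1.trans ht.1, by linarith [ht.2, hh'.2]⟩)]
  have hlim := le_of_tendsto_of_tendsto T2 ((((T1.add S1).sub S2).sub T3).sub T4) (by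
    filter_upwards [hpos, Ioo_mem_nhdsGT (show (0 : ℝ) < min t₁ (T - t₂) by
      exact lt_min ht₁ (by linarith))] with h hh hh'
    exact hB4 h hh (hh'.2.trans_le (min_le_left _ _))
      (by linarith [hh'.2.trans_le (min_le_right t₁ (T - t₂))]))
  ----------------------------------------------------------------
  -- identification of the limits with the slab integrals, and `η′ ≤ |η′|`
  ----------------------------------------------------------------
  have I2 := setIntegral_Icc_univ_eq_cutoff (T := T) ht₁ ht₂
    (F := fun p : ℝ × EuclideanSpace ℝ (Fin 3) =>
      η p.1 * (deriv (deriv H) (V p.1 p.2) * ‖gradient (V p.1) p.2‖ ^ 2 * Θ p.2 ^ 2))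
    (fun p hp => by simp only [hΘ1 p.2 hp]; ring)
  have I3 := setIntegral_Icc_univ_eq_cutoff (T := T) ht₁ ht₂
    (F := fun p : ℝ × EuclideanSpace ℝ (Fin 3) =>
      η p.1 * (deriv H (V p.1 p.2) * ⟪gradient (V p.1) p.2, gradient (fun y => Θ y ^ 2) p.2⟫))
    (fun p hp => by simp only [hgradΘ1 p.2 hp, inner_zero_right]; ring)
  have I4 := setIntegral_Icc_univ_eq_cutoff (T := T) ht₁ ht₂
    (F := fun p : ℝ × EuclideanSpace ℝ (Fin 3) =>
      η p.1 * (Θ p.2 ^ 2 * (deriv H (V p.1 p.2) * ⟪b p.1 p.2, gradient (V p.1) p.2⟫)))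
    (fun p hp => by simp only [hΘ1 p.2 hp]; ring)
  have I1 := setIntegral_Icc_univ_eq_cutoff (T := T) ht₁ ht₂
    (F := fun p : ℝ × EuclideanSpace ℝ (Fin 3) => |deriv η p.1| * (H (V p.1 p.2) * Θ p.2 ^ 2))
    (fun p hp => by simp only [hΘ1 p.2 hp]; ring)
  have hind_int : ∀ {F : ℝ × EuclideanSpace ℝ (Fin 3) → ℝ}, Integrable F (volume.restrict W) →
      Integrable (fun p => (Icc t₁ t₂).indicator (1 : ℝ → ℝ) p.1 * F p) (volume.restrict W) := by
    intro F hF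
    refine hF.bdd_mul (c := 1)
      (((measurable_const.indicator measurableSet_Icc).comp measurable_fst).aestronglyMeasurable) ?_
    refine Eventually.of_forall fun p => ?_
    rw [Real.norm_eq_abs]
    by_cases hp : p.1 ∈ Icc t₁ t₂
    · rw [indicator_of_mem hp, Pi.one_apply, abs_one]
    · rw [indicator_of_notMem hp, abs_zero]; exact zero_le_one
  have hmono : ∫ p in W, (Icc t₁ t₂).indicator (1 : ℝ → ℝ) p.1 * (deriv η p.1 * (H (V p.1 p.2) * Θ p.2 ^ 2)) ≤
      ∫ p in W, (Icc t₁ t₂).indicator (1 : ℝ → ℝ) p.1 * (|deriv η p.1| * (H (V p.1 p.2) * Θ p.2 ^ 2)) := by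
    refine integral_mono (hind_int hG₁) (hind_int hG₁') fun p => ?_
    have hGp : 0 ≤ H (V p.1 p.2) * Θ p.2 ^ 2 := mul_nonneg (hH0 _) (sq_nonneg _)
    exact mul_le_mul_of_nonneg_left (mul_le_mul_of_nonneg_right (le_abs_self _) hGp)
      (indicator_nonneg (fun _ _ => zero_le_one) _)
  rw [I1, I2, I3, I4]
  linarith

end Summit.NavierStokesRegularity.NavierStokesRegularity.Theorems.AveragedConeLiouville.NUPositivity

end
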